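import Literature.NumberTheory.Automorphic.BrandtMatrixUnitCount
import Literature.NumberTheory.Automorphic.DefiniteOrderUnitsFinite
import Mathlib.GroupTheory.GroupAction.Quotient
import HarnessLib

/-!
# Route `RamifiedHeegnerPair`, crux U₁ `LeafRankOneUpperAtThree` (stmt-BirchSwinnertonDyer-26022), line `partnerdescent` —
# input (C4) of the (G3♭ˢ) derivation: the divisibility (DIV) `w_k ∣ T(n)_{ik}` reduced to «no unit `≠ ±1` of `O_L(I_k)` fixes a counted sub-ideal»

HONEST FRAMING. Theorems only; helper file (`--supports stmt-BirchSwinnertonDyer-26022 --as helper`); an orbit count (Burnside's lemma) over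
the tree's Brandt vocabulary (`Brandt.matrix`, `Brandt.weight`, `Brandt.unitIndex`, `MulAction.stabilizer Dˣ I`; `BrandtMatrixUnitCount.lean`);
no named fact, no `sorry`; nothing booked; BSD is proved for no curve. Lead prover bsd-line-rhp-p2 g61, 2026-08-31 (memo
`Cruxes/LeafRankOneUpperAtThree/LEAD-G61-G3-CORE.md` §7). Companion of ‹…LeafPartnerBrandtExactEisenstein› (exact Eisenstein ⟸ (DIV)).

WHAT. The Brandt entry `T(n)_{ik}` counts the sub-ideals `J = αI_i ⊆ I_k` of index `n²` (tree convention, Voight (41.1.1)). The stabiliser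
`Stab(I_k) = O_L(I_k)^×` (order `2w_k`; tree `card_stabilizer_eq_two_mul_unitIndex`) acts on this finite set by `J ↦ uJ` (`smul_mem_brandtSet`),
`±1` acting trivially. IF no other unit fixes a counted `J` (hypothesis `hfree` — for `[I_i] ≠ [I_k]` and `n = ℓ ∤ N⁺N⁻` prime this is the
elementary fixed-point exclusion of the memo: a fixed `J` is `πI_k` for a norm-`ℓ` element `π ∈ ℤ[u]`, forcing `[I_i] = [I_k]`; NOT proved here),
then every orbit has exactly `w_k` elements and **`w_k ∣ T(n)_{ik}`** (`unitIndex_dvd_ncard_brandtSet_of_forall_smul_ne`, Burnside's lemma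
`MulAction.sum_card_fixedBy_eq_card_orbits_mul_card_group`: `Σ_u #Fix(u) = 2·#B = #orbits · 2w_k`), and for a Brandt setup
`XiSetup.weight_dvd_matrix_of_forall_smul_ne`. With ‹…BrandtExactEisenstein› this makes the EXACT Eisenstein property of the degree-zero Brandt
component group, and the exact `hEis` `i_r ∣ a_ℓ − ℓ − 1`, depend on the fixed-point exclusion alone.
[cite: Voight2021, (41.1.1) and 41.1.3 (`w_i = #O_i^×/2`), Lemma 17.7.13] [cite: Gross1987, §1]
-/

set_option linter.dupNamespace false
set_option autoImplicit false

noncomputable section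

open scoped Pointwise

namespace Summit.BirchSwinnertonDyer.BirchSwinnertonDyer.Theorems.LeafPartnerBrandt

open Literature.NumberTheory.Automorphic Literature.NumberTheory.Automorphic.Brandt

section OrbitCount

variable {D : Type*} [Ring D]

/-- The stabiliser of `I` acts on the set counted by a Brandt entry with ambient ideal `I`: `uI = I` and `J = αI' ⊆ I` of index `n²` give
`uJ = (uα)I' ⊆ I` of index `n²`. [cite: Voight2021, (41.1.1)] -/
theorem smul_mem_brandtSet {I' I : Submodule ℤ D} {n : ℕ} {u : Dˣ} (hu : u • I = I) {J : Submodule ℤ D}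
    (hJ : J ∈ {J : Submodule ℤ D | J ≤ I ∧ J.toAddSubgroup.relIndex I.toAddSubgroup = n ^ 2 ∧ ∃ α : Dˣ, J = α • I'}) :
    u • J ∈ {J : Submodule ℤ D | J ≤ I ∧ J.toAddSubgroup.relIndex I.toAddSubgroup = n ^ 2 ∧ ∃ α : Dˣ, J = α • I'} := by
  have h := brandtSet_smul_right u n I' I
  rw [hu] at h
  rw [h]
  exact Set.mem_image_of_mem _ hJ

/-- **`w(O_L I) ∣ #{J ⊆ I : [I : J] = n², J ∈ Dˣ I'}` when no unit other than `±1` fixes a counted `J`.** For lattices `I', I` of a ring with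
`1 ≠ −1`, with the counted set and the stabiliser `Stab(I) = O_L(I)^×` finite: if `uJ = J` with `uI = I` and `J` counted forces `u = ±1`, then
`unitIndex (O_L I) = #Stab(I)/2` divides the count. Burnside: `Σ_{u ∈ Stab(I)} #Fix(u) = #Fix(1) + #Fix(−1) = 2·#B` equals `#orbits · #Stab(I)
= #orbits · 2 w`. [cite: Voight2021, 41.1.3 and Lemma 17.7.13] -/
theorem unitIndex_dvd_ncard_brandtSet_of_forall_smul_ne (hne : (1 : D) ≠ -1) (I' I : Submodule ℤ D) (n : ℕ)
    (hB : {J : Submodule ℤ D | J ≤ I ∧ J.toAddSubgroup.relIndex I.toAddSubgroup = n ^ 2 ∧ ∃ α : Dˣ, J = α • I'}.Finite)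
    (hG : (MulAction.stabilizer Dˣ I : Set Dˣ).Finite)
    (hfree : ∀ u : Dˣ, u • I = I →
      ∀ J ∈ {J : Submodule ℤ D | J ≤ I ∧ J.toAddSubgroup.relIndex I.toAddSubgroup = n ^ 2 ∧ ∃ α : Dˣ, J = α • I'},
        u • J = J → u = 1 ∨ u = -1) :
    unitIndex (leftOrder I) ∣
      {J : Submodule ℤ D | J ≤ I ∧ J.toAddSubgroup.relIndex I.toAddSubgroup = n ^ 2 ∧ ∃ α : Dˣ, J = α • I'}.ncard := by
  classical
  set B : Set (Submodule ℤ D) :=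
    {J : Submodule ℤ D | J ≤ I ∧ J.toAddSubgroup.relIndex I.toAddSubgroup = n ^ 2 ∧ ∃ α : Dˣ, J = α • I'} with hBdef
  set G : Subgroup Dˣ := MulAction.stabilizer Dˣ I with hGdef
  haveI : Fintype B := hB.fintype
  haveI : Finite G := hG
  haveI : Fintype G := Fintype.ofFinite G
  -- the action of `G` on `B`
  letI : MulAction G B :=
    { smul := fun g J => ⟨(g : Dˣ) • (J : Submodule ℤ D), smul_mem_brandtSet (MulAction.mem_stabilizer_iff.mp g.2) J.2⟩
      one_smul := fun J => Subtype.ext (one_smul Dˣ (J : Submodule ℤ D))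
      mul_smul := fun g h J => Subtype.ext (mul_smul (g : Dˣ) (h : Dˣ) (J : Submodule ℤ D)) }
  have hsmul : ∀ (g : G) (J : B), ((g • J : B) : Submodule ℤ D) = (g : Dˣ) • (J : Submodule ℤ D) := fun _ _ => rfl
  -- the two central elements `1, −1` of `G`
  have hneg : (-1 : Dˣ) ∈ G := neg_one_mem_stabilizer I
  let m : G := ⟨-1, hneg⟩
  have h1m : (1 : G) ≠ m := by
    intro h
    have h' : ((1 : G) : Dˣ) = (m : Dˣ) := congrArg Subtype.val h
    exact hne (by simpa [m] using congrArg Units.val h')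
  -- fixed points: everything under `1` and `−1`, nothing under any other `g`
  have hfix_all : ∀ g : G, ((g : Dˣ) = 1 ∨ (g : Dˣ) = -1) → Fintype.card (MulAction.fixedBy B g) = Fintype.card B := by
    intro g hg
    refine Fintype.card_of_subtype (Finset.univ : Finset B) (fun J => ?_)
    simp only [Finset.mem_univ, true_iff, MulAction.mem_fixedBy]
    apply Subtype.ext
    rw [hsmul]
    rcases hg with hg | hg
    · rw [hg, one_smul]
    · rw [hg]
      exact MulAction.mem_stabilizer_iff.mp (neg_one_mem_stabilizer (J : Submodule ℤ D))
  have hfix_none : ∀ g : G, ¬ ((g : Dˣ) = 1 ∨ (g : Dˣ) = -1) → Fintype.card (MulAction.fixedBy B g) = 0 := by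
    intro g hg
    rw [Fintype.card_eq_zero_iff]
    refine ⟨fun ⟨J, hJ⟩ => hg ?_⟩
    rw [MulAction.mem_fixedBy] at hJ
    exact hfree (g : Dˣ) (MulAction.mem_stabilizer_iff.mp g.2) J J.2 (by rw [← hsmul]; exact congrArg Subtype.val hJ)
  -- Burnside
  have hburn := MulAction.sum_card_fixedBy_eq_card_orbits_mul_card_group G B
  rw [Finset.sum_eq_add (1 : G) m h1m (fun g _ hg => hfix_none g (fun h => by
      rcases h with h | h
      · exact hg.1 (Subtype.ext h)
      · exact hg.2 (Subtype.ext h)))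
    (fun h => absurd (Finset.mem_univ _) h) (fun h => absurd (Finset.mem_univ _) h),
    hfix_all 1 (Or.inl rfl), hfix_all m (Or.inr rfl)] at hburn
  -- `2 #B = #orbits · #G`, `#G = 2 w`
  have hcardG : Fintype.card G = 2 * unitIndex (leftOrder I) := by
    rw [Fintype.card_eq_nat_card]; exact card_stabilizer_eq_two_mul_unitIndex hne I
  have hcardB : Fintype.card B = B.ncard := by rw [Fintype.card_eq_nat_card, Nat.card_coe_set_eq]
  rw [hcardG, hcardB] at hburn
  refine ⟨Fintype.card (MulAction.orbitRel.Quotient G B), ?_⟩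
  linarith

end OrbitCount

section Setup

variable {Nplus Nminus : ℕ} (S : XiSetup Nplus Nminus)

/-- **`w_k ∣ T(n)_{ik}` for a Brandt setup, granted the fixed-point exclusion on the representatives**: if every unit `u` of `O_L(I_k)` fixing a
counted sub-ideal `J = αI_i ⊆ I_k` of index `n²` is `±1`, then the weight `w_k` divides the Brandt entry `T(n)_{ik}`. For `i ≠ k` and `n = ℓ`
a prime not dividing `N⁺N⁻` the hypothesis is the elementary exclusion of the memo (a fixed `J` would be `πI_k`, `π ∈ ℤ[u]` of norm `ℓ`,
so `[I_i] = [I_k]`); feeding the conclusion to `exact_eisenstein_of_weight_dvd` ∕ `dvd_sub_of_eigenvector_of_weight_dvd` gives the EXACT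
Eisenstein property. [cite: Voight2021, (41.1.1), 41.1.3, Lemma 17.7.13] -/
theorem XiSetup.weight_dvd_matrix_of_forall_smul_ne {n : ℕ} (hn : n ≠ 0) (i k : ClassSet S.O)
    (hfree : ∀ u : S.Dˣ, u • k.rep = k.rep →
      ∀ J ∈ {J : Submodule ℤ S.D | J ≤ k.rep ∧ J.toAddSubgroup.relIndex k.rep.toAddSubgroup = n ^ 2 ∧ ∃ α : S.Dˣ, J = α • i.rep},
        u • J = J → u = 1 ∨ u = -1) :
    (weight S.O k : ℤ) ∣ matrix S.O n i k := by
  haveI : IsAddTorsionFree S.D := isAddTorsionFree_of_charZero_module ℚ S.D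
  have hB := finite_brandtSet i k hn
  have hG : (MulAction.stabilizer S.Dˣ k.rep : Set S.Dˣ).Finite := by
    obtain ⟨e⟩ := nonempty_stabilizerEquivUnits k.rep
    haveI : Finite {x : S.D // x ∈ leftOrder k.rep ∧ ∃ y ∈ leftOrder k.rep, x * y = 1 ∧ y * x = 1} :=
      (S.finite_units k).to_subtype
    exact (Finite.of_equiv _ e.symm : Finite (MulAction.stabilizer S.Dˣ k.rep))
  have h := unitIndex_dvd_ncard_brandtSet_of_forall_smul_ne S.one_ne_neg_one i.rep k.rep n hB hG hfree
  rw [matrix, Matrix.of_apply, weight]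
  exact_mod_cast h

end Setup

/-! ## Appended (same seat, lead g61): the UNCONDITIONAL half — `w_k ∣ w_i · T(n)_{ik}`, so (DIV) holds whenever `gcd(w_i, w_k) = 1`

The stabiliser `Stab(I_k) = O_L(I_k)^×` (order `2w_k`) acts FREELY by left multiplication on the set of ELEMENTS
`A_{ik} = {α ∈ Dˣ : αI_i ⊆ I_k, [I_k : αI_i] = n²}` (a unit with `uα = α` is `1`), whose cardinality is `2w_i · T(n)_{ik}` (tree
`two_mul_weight_mul_matrix_apply`, the right action of `O_L(I_i)^×`). Burnside again: `#A = #orbits · 2w_k`. Hence `2w_k ∣ 2w_i T(n)_{ik}`, i.e.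
**`w_k ∣ w_i · T(n)_{ik}` with no hypothesis** — (DIV) is automatic for every pair of classes with coprime weights, in particular whenever
`w_i = 1` (the generic class); the fixed-point exclusion is needed only for pairs `i ≠ k` sharing extra automorphisms (`gcd(w_i, w_k) ∈ {2, 3, …}`). -/

section Unconditional

variable {D : Type*} [Ring D]

/-- Left multiplication by a unit `u` with `uI = I` preserves `A(I', I, n) = {α ∈ Dˣ : αI' ⊆ I, [I : αI'] = n²}`. [cite: Voight2021, 41.1.3] -/
theorem mul_mem_brandtElemSet {I' I : Submodule ℤ D} {n : ℕ} {u : Dˣ} (hu : u • I = I) {α : Dˣ}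
    (hα : α • I' ≤ I ∧ (α • I').toAddSubgroup.relIndex I.toAddSubgroup = n ^ 2) :
    (u * α) • I' ≤ I ∧ ((u * α) • I').toAddSubgroup.relIndex I.toAddSubgroup = n ^ 2 := by
  refine ⟨?_, ?_⟩
  · rw [mul_smul, ← hu]
    exact (units_smul_le_units_smul_iff u).mpr hα.1
  · rw [mul_smul]
    conv_lhs => rw [← hu]
    rw [relIndex_units_smul]
    exact hα.2

/-- **`#Stab(I) ∣ #A(I', I, n)`**: the stabiliser of `I` acts freely on `A(I', I, n)` by left multiplication (both finite). Burnside's lemma with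
`Fix(1) = A`, `Fix(u) = ∅` for `u ≠ 1`. [cite: Voight2021, 41.1.3 and Lemma 17.7.13] -/
theorem card_stabilizer_dvd_card_brandtElemSet (I' I : Submodule ℤ D) (n : ℕ)
    (hA : Finite {α : Dˣ // α • I' ≤ I ∧ (α • I').toAddSubgroup.relIndex I.toAddSubgroup = n ^ 2})
    (hG : (MulAction.stabilizer Dˣ I : Set Dˣ).Finite) :
    Nat.card (MulAction.stabilizer Dˣ I) ∣
      Nat.card {α : Dˣ // α • I' ≤ I ∧ (α • I').toAddSubgroup.relIndex I.toAddSubgroup = n ^ 2} := by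
  classical
  set A := {α : Dˣ // α • I' ≤ I ∧ (α • I').toAddSubgroup.relIndex I.toAddSubgroup = n ^ 2} with hAdef
  set G : Subgroup Dˣ := MulAction.stabilizer Dˣ I with hGdef
  haveI : Fintype A := Fintype.ofFinite A
  haveI : Finite G := hG
  haveI : Fintype G := Fintype.ofFinite G
  letI : MulAction G A :=
    { smul := fun g a => ⟨(g : Dˣ) * a.1, mul_mem_brandtElemSet (MulAction.mem_stabilizer_iff.mp g.2) a.2⟩
      one_smul := fun a => Subtype.ext (one_mul a.1)
      mul_smul := fun g h a => Subtype.ext (mul_assoc (g : Dˣ) (h : Dˣ) a.1) }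
  have hsmul : ∀ (g : G) (a : A), ((g • a : A) : Dˣ) = (g : Dˣ) * (a : Dˣ) := fun _ _ => rfl
  -- fixed points: all of `A` under `1`, none under `g ≠ 1`
  have hfix_one : Fintype.card (MulAction.fixedBy A (1 : G)) = Fintype.card A := by
    refine Fintype.card_of_subtype (Finset.univ : Finset A) (fun a => ?_)
    simp only [Finset.mem_univ, MulAction.mem_fixedBy, one_smul]
  have hfix_none : ∀ g : G, g ≠ 1 → Fintype.card (MulAction.fixedBy A g) = 0 := by
    intro g hg
    rw [Fintype.card_eq_zero_iff]
    refine ⟨fun ⟨a, ha⟩ => hg ?_⟩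
    rw [MulAction.mem_fixedBy] at ha
    have h : (g : Dˣ) * (a : Dˣ) = (a : Dˣ) := by rw [← hsmul]; exact congrArg Subtype.val ha
    exact Subtype.ext (mul_right_cancel (h.trans (one_mul (a : Dˣ)).symm))
  have hburn := MulAction.sum_card_fixedBy_eq_card_orbits_mul_card_group G A
  rw [Finset.sum_eq_single (1 : G) (fun g _ hg => hfix_none g hg) (fun h => absurd (Finset.mem_univ _) h), hfix_one] at hburn
  rw [← Fintype.card_eq_nat_card, ← Fintype.card_eq_nat_card, hburn]
  exact Dvd.intro_left _ rfl

end Unconditional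

section SetupUnconditional

variable {Nplus Nminus : ℕ} (S : XiSetup Nplus Nminus)

/-- **`w_k ∣ w_i · T(n)_{ik}`, unconditionally, for every Brandt setup and all classes `i, k`.** So the divisibility (DIV) `w_k ∣ T(n)_{ik}`
holds for free whenever `gcd(w_i, w_k) = 1` (e.g. `w_i = 1`), and the fixed-point exclusion of `XiSetup.weight_dvd_matrix_of_forall_smul_ne` is
needed only for pairs of classes with a common extra automorphism. [cite: Voight2021, (41.1.1), 41.1.3, Lemma 17.7.13] -/
theorem XiSetup.weight_dvd_weight_mul_matrix (n : ℕ) (i k : ClassSet S.O) :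
    (weight S.O k : ℤ) ∣ (weight S.O i : ℤ) * matrix S.O n i k := by
  have hG : (MulAction.stabilizer S.Dˣ k.rep : Set S.Dˣ).Finite := by
    obtain ⟨e⟩ := nonempty_stabilizerEquivUnits k.rep
    haveI : Finite {x : S.D // x ∈ leftOrder k.rep ∧ ∃ y ∈ leftOrder k.rep, x * y = 1 ∧ y * x = 1} :=
      (S.finite_units k).to_subtype
    exact (Finite.of_equiv _ e.symm : Finite (MulAction.stabilizer S.Dˣ k.rep))
  -- `#A = 2 w_i T(n)_{ik}`; if `A` is infinite both `Nat.card A = 0` and the entry vanish, so finiteness can be assumed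
  have hcount := S.two_mul_weight_mul_matrix_apply n i k
  by_cases hfin : Finite {α : S.Dˣ // α • i.rep ≤ k.rep ∧ (α • i.rep).toAddSubgroup.relIndex k.rep.toAddSubgroup = n ^ 2}
  · have h := card_stabilizer_dvd_card_brandtElemSet i.rep k.rep n hfin hG
    rw [card_stabilizer_eq_two_mul_unitIndex S.one_ne_neg_one] at h
    have h' : (2 * (weight S.O k : ℤ)) ∣ 2 * ((weight S.O i : ℤ) * matrix S.O n i k) := by
      rw [← mul_assoc, hcount, weight]
      exact_mod_cast h
    exact (mul_dvd_mul_iff_left two_ne_zero).mp h'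
  · haveI := not_finite_iff_infinite.mp hfin
    rw [Nat.card_eq_zero_of_infinite] at hcount
    have h0 : (weight S.O i : ℤ) * matrix S.O n i k = 0 := by
      have : (2 : ℤ) * ((weight S.O i : ℤ) * matrix S.O n i k) = 0 := by
        rw [← mul_assoc]; exact_mod_cast hcount
      simpa using this
    rw [h0]
    exact dvd_zero _

end SetupUnconditional

end Summit.BirchSwinnertonDyer.BirchSwinnertonDyer.Theorems.LeafPartnerBrandt

end
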